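import Literature.MathematicalPhysics.QuantumFieldTheory.Balaban1983to89.Node00.Record13SepCoPH
import Literature.MathematicalPhysics.QuantumFieldTheory.Balaban1983to89.Node00.Record13SepCoPHChi

/-!
# NODE 00 — RC-1∕CL «record-CLASS layer» (◆ CRIT-1 RULING (d-i) CENTRE MAP, nodeO S.4053, pub-ymgap I.21487) · OP 5b SUPPLY (i) (✦ plan g99 I.21959, the named
# consumer = the K1ᴬ v11 skeleton; census node00-def-RR-2 g26 I.22145): the v1.4∕H (SepCoPH) record predicate READ THROUGH A CENTRE MAP `Χ : Stage13Params F N → ChiSlot F N`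
# — `IsRecordOfRecord₁₃CSepCoPHCmap Χ D w` — its receipt to the class of record (`Χ := chiβOfRecord₁₃`), `[Ax-3d]`'s constant-slot class as the case
# `Χ := fun _ => χ`, the Ax class `IsRecordOfRecord₁₃CSepCoPHCAx` (`Χ := chiβOfRecord₁₃Ax`), its CONSEQUENCES (provisos ∕ construction ∕ window ∕ Stage-0 datum), the §11c
# SHADOW proof device re-issued at a fixed β-slot `χ`, and the DOORS every world-reading node statement walks through: `exists_isRecordOfRecord₅C_of_…{Cmap,CAx}`,
# `atWorld_of_…{Cmap,CAx}`, the guarded (0.20) leaf `rgFlow_of_smallCouplings_of_…{Cmap,CAx}` and `endStatementBPrinted_of_…{Cmap,CAx}_of_nodes`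

CITATION HEADER.  [V] = [Balaban1989LargeFieldII] Thm 1 + (0.1) pp.355–356 (the objects of record); [III] = [Balaban1988Convergent] (0.2) p.244, (2.17)–(2.18) p.257,
Thms 1–2 pp.262–263; [IV] = [Balaban1989LargeFieldI] (0.2)–(0.4) p.176 (the 𝐑-operation, the induced operation at the tower); [I] = [Balaban1987RG1] (2.9) p.266 with
p.265 (2.3) and p.268 (the cut-off's centre is a function of the record's ε-parameters — why the slot must CO-VARY with θ under the class's `∃ θ`), (0.20) p.256 (the guarded
flow statement), (0.13) p.254.  Parents of record (UNTOUCHED, body-freeze №460 (2)): `Node00/Record13SepCoPH` :440 `IsRecordOfRecord₁₃CSepCoPH` with its consequences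
:475–:497, the §11c shadow :542–:596 and the doors ∕ transferred leaves :602–:652; `[Ax-3d]` `Node00/Record13SepCoPHChi` :381 `IsRecordOfRecord₁₃CSepCoPHChi (χ)`
(constant slot) and its χ-generic objects `towerOfRecord₁₃SepCoPHChi` :189, `datumOfRecord₁₃SepCoPHChi` :198, `isIntegrable_towerOfRecord₁₃SepCoPH_chi` :232; `[Ax-3c]`
`Node00/Record13CoPHChi` :309 `residualOfStage13CoPHChi`, :322 `toStage5₁₃CoPHChi`, :342 `coreOfRecord₁₃CoPHChi`, :210 `S218OfRecord₁₃CoPHChi`; `[Ax-3b]` `Node00/Record13Chi`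
:69 `densOfRecord₁₃Chi`.

WHY (ruling (d-i) term (γ): «filed only when a NAMED consumer names `IsRecordOfRecord₁₃CSepCoPHCAx`» — ✦ plan g99 I.21959 names it: the K1ᴬ v11 skeleton's `RecordS`∕record
clauses carry `h′ : θ′.Provisos₁₃SepCoPHAx` and feed the TREE predicates `IsRecordOfRecord₁₃CSepCoPH{,S}` whose ∃-binder is the non-Ax proviso — «Application type mismatch»;
its consumers are `rgFlow_of_smallCouplings_of_isRecordOfRecord₁₃CSepCoPH{,S}` and the END chain).  THIS FILE is the C-side supply: ROW (1) the classes + pointed intro +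
inhabitation + consequences, ROW (3) the shadow door and the guarded (0.20) ∕ END leaves — each Cmap-GENERIC (any centre map `Χ`) with the Ax instance OF THE PARENT'S ARITY
(`…CAx` = `…Cmap` at `Χ := chiβOfRecord₁₃Ax F N`, definitional).  ROW (2), the S-class twin (`upOfRecord₅CS`), is node00-def-RR-2's file `Node00/Record13SClassSepCoPHChiCmap`
over this one; ROW (4) `…_reletter_of_le…Ax` is Summits-side (dag-n24-c).  TERMS: (α) NEW NAMES ONLY, parents untouched, append-only; (β) scope = exactly the named consumer's
rows + the shadow they stand on; N01∕N02∕N04 `b4∕b5∕b7_main_…` instances are left lazy (one-liners over `atWorld_of_…Cmap` when a consumer names them, D-0026).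
NAMING: centre-map-generic objects∕rows carry the token `Cmap` where the parent has none and take `(Χ : CentreMap F N)` (explicit on objects, implicit `{Χ}` on rows keyed by a
class hypothesis); rows at a FIXED slot `χ` (the shadow §) are the parent's name + `Chi`∕`_chi` with `(χ : ChiSlot F N)` after `θ` (the `[Ax-3d]` pattern); Ax instances = the
parent's name with `CSepCoPH ↦ CSepCoPHCAx`, SAME ARITY as the parent.
HONEST FRAMING.  One definition over a parameter, abbrevs, two proof-device definitions at a χ, and `rfl`∕one-line faces — the SAME bookkeeping as the parents, re-keyed;
provisos stay HYPOTHESES (`h : θ.Provisos₁₃SepCoPHChi F N (Χ θ.toStage13Params)` inside the class); nothing of Bałaban's asserted, ported or discharged; no closed value of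
E_k ∕ log z_k ∕ χ pinned; no `sorry`∕`instance`∕`notation`∕`axiom`; standard axioms; K0ᴬ∕K1ᴬ∕K3ᴬ stay OPEN; finite 𝕋⁴ at fixed ε — NOT continuum∕OS∕Clay; the Yang–Mills
mass gap (Clay) is NOT proved by any of this.
-/

noncomputable section

open MeasureTheory
open scoped Matrix.Norms.L2Operator

namespace Literature.MathematicalPhysics.QuantumFieldTheory.Balaban1983to89.Node00

open T4Continuum AveragingRT T4FiniteEpsInhabited FlowStep FlowStepRuns DagBinding T4DatumAssembly

variable (F : T4Family) (N : ℕ) [NeZero N]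

/-! ## §1. ROW (1): the centre-map class, receipts, the Ax class, pointed intro, inhabitation (STAGED 881e79cad1c438eb §§ verbatim) -/

/-- A CENTRE MAP: one β-slot small-field function per Stage-13 parameter — the shape of BOTH centres of record (`chiβOfRecord₁₃ F N θ = chiFixed29 F N θ.ν θ.ε₂₉`,
`chiβOfRecord₁₃Ax F N θ = chiFixed29Ax F N θ.ν θ.ε₂₉`, `rfl`). [cite: Balaban1987RG1, (2.9) p.266, p.268 (the cut-off's thresholds are the record's ε-parameters; bookkeeping)] -/
abbrev CentreMap : Type _ := Stage13Params F N → ChiSlot F N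

/-- (d-i) **THE CENTRE-MAP-GENERIC RECORD PREDICATE, SepCoPH layer — «(D, w) is the record, Stage 13, β-slot read through `Χ`»**: `Node00/Record13SepCoPH` :440
VERBATIM with the slot `Χ θ.toStage13Params` (θ bound INSIDE the `∃`, so the slot co-varies with θ as print's (2.9) cut-off does).
[cite: Balaban1989LargeFieldII, Thm 1 + (0.1) pp.355–356; Balaban1988Convergent, (0.2) p.244, (2.17)–(2.18) p.257; Balaban1987RG1, (2.9) p.266 (bookkeeping)] -/
def IsRecordOfRecord₁₃CSepCoPHCmap (Χ : CentreMap F N) (D : FiniteEpsData F (SU N)) (w : WorldP) : Prop :=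
  ∃ (θ : Stage13HParams F N) (h : θ.Provisos₁₃SepCoPHChi F N (Χ θ.toStage13Params)), θ.Admissible F N ∧
    D = datumOfRecord₁₃SepCoPHChi F N θ (Χ θ.toStage13Params) h ∧ w.C = D.C ∧ (0 < w.γ ∧ w.γ ≤ θ.γ) ∧
    w.L = (θ.L : ℝ) ∧ ∀ P : B12.RunParams, w.up P = upOfRecord₅C F N (θ.toStage5₁₃CoPHChi F N (Χ θ.toStage13Params)) P

variable {F N}

/-- **RECEIPT**: at the centre of record `Χ := chiβOfRecord₁₃ F N` the centre-map class IS the class of record `IsRecordOfRecord₁₃CSepCoPH` (transport through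
`provisos₁₃SepCoPHChi_chiβ_iff`; the datum ∕ Stage-5 clauses are definitional). [cite: Balaban1989LargeFieldII, Thm 1 + (0.1) pp.355–356 (bookkeeping)] -/
theorem isRecordOfRecord₁₃CSepCoPHCmap_chiβ_iff (D : FiniteEpsData F (SU N)) (w : WorldP) :
    IsRecordOfRecord₁₃CSepCoPHCmap F N (chiβOfRecord₁₃ F N) D w ↔ IsRecordOfRecord₁₃CSepCoPH F N D w := by
  constructor
  · rintro ⟨θ, h, hθ, hD, hC, hγ, hL, hup⟩
    exact ⟨θ, (provisos₁₃SepCoPHChi_chiβ_iff θ).1 h, hθ, hD, hC, hγ, hL, hup⟩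
  · rintro ⟨θ, h, hθ, hD, hC, hγ, hL, hup⟩
    exact ⟨θ, (provisos₁₃SepCoPHChi_chiβ_iff θ).2 h, hθ, hD, hC, hγ, hL, hup⟩

/-- **`[Ax-3d]`'s constant-slot class IS the special case `Χ := fun _ => χ`** (`Iff.rfl`; `Node00/Record13SepCoPHChi` :381 untouched).
[cite: Balaban1989LargeFieldII, Thm 1 + (0.1) pp.355–356 (bookkeeping)] -/
theorem isRecordOfRecord₁₃CSepCoPHChi_iff_cmap_const (χ : ChiSlot F N) (D : FiniteEpsData F (SU N)) (w : WorldP) :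
    IsRecordOfRecord₁₃CSepCoPHChi F N χ D w ↔ IsRecordOfRecord₁₃CSepCoPHCmap F N (fun _ => χ) D w := Iff.rfl

variable (F N)

/-- **THE Ax CLASS** (one token): «(D, w) is the record, Stage 13» RE-CENTRED at print's block-axial critical configuration — the centre-map class at
`Χ := chiβOfRecord₁₃Ax F N`. [cite: Balaban1989LargeFieldII, Thm 1 + (0.1) pp.355–356; Balaban1987RG1, (2.9) p.266 with p.265 (2.3) (the axial representative; bookkeeping)] -/
abbrev IsRecordOfRecord₁₃CSepCoPHCAx (D : FiniteEpsData F (SU N)) (w : WorldP) : Prop :=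
  IsRecordOfRecord₁₃CSepCoPHCmap F N (chiβOfRecord₁₃Ax F N) D w

/-- Pointed intro of the Ax class at `[Ax-3d]`'s Ax datum `datumOfRecord₁₃SepCoPHAx F N θ h`. [cite: Balaban1989LargeFieldII, Thm 1 + (0.1) pp.355–356 (bookkeeping)] -/
theorem isRecordOfRecord₁₃CSepCoPHCAx_of_eq (θ : Stage13HParams F N) (h : θ.Provisos₁₃SepCoPHAx F N) (hθ : θ.Admissible F N) (w : WorldP)
    (hC : w.C = (datumOfRecord₁₃SepCoPHAx F N θ h).C) (hγ : 0 < w.γ ∧ w.γ ≤ θ.γ) (hL : w.L = (θ.L : ℝ))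
    (hup : ∀ P, w.up P = upOfRecord₅C F N (θ.toStage5₁₃CoPHChi F N (chiβOfRecord₁₃Ax F N θ.toStage13Params)) P) :
    IsRecordOfRecord₁₃CSepCoPHCAx F N (datumOfRecord₁₃SepCoPHAx F N θ h) w :=
  ⟨θ, h, hθ, rfl, hC, hγ, hL, hup⟩

/-- Every admissible θ with the Ax provisos IS an Ax-class record at some world, with any window `0 < γw ≤ θ.γ`.
[cite: Balaban1989LargeFieldII, Thm 1 + (0.1) pp.355–356; Balaban1988Convergent, (2.17)–(2.18) p.257 (bookkeeping)] -/
theorem exists_world_isRecordOfRecord₁₃CSepCoPHCAx (θ : Stage13HParams F N) (h : θ.Provisos₁₃SepCoPHAx F N) (hθ : θ.Admissible F N)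
    {γw : ℝ} (hγw : 0 < γw ∧ γw ≤ θ.γ) :
    ∃ w : WorldP, IsRecordOfRecord₁₃CSepCoPHCAx F N (datumOfRecord₁₃SepCoPHAx F N θ h) w ∧ w.γ = γw := by
  obtain ⟨w₀⟩ := nonempty_worldP
  exact ⟨{ w₀ with
      C := (datumOfRecord₁₃SepCoPHAx F N θ h).C, γ := γw, L := (θ.L : ℝ), one_lt_L := by exact_mod_cast θ.hL.2,
      up := fun P => upOfRecord₅C F N (θ.toStage5₁₃CoPHChi F N (chiβOfRecord₁₃Ax F N θ.toStage13Params)) P },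
    ⟨θ, h, hθ, rfl, rfl, hγw, rfl, fun _ => rfl⟩, rfl⟩


/-! ## §2. ROW (1)⁺: CONSEQUENCES of a centre-map record — provisos, construction, window, Stage-0 datum (parents :475–:497, one line each; Ax instances of the parent's arity) -/

section ConsequencesCmap

variable {F N}
variable {Χ : CentreMap F N} {D : FiniteEpsData F (SU N)} {w : WorldP}

/-- A centre-map record CERTIFIES its parameters' (χ-generic) provisos and admissibility — parent :475 with `Provisos₁₃SepCoPH ↦ Provisos₁₃SepCoPHChi (Χ θ)`,
`datumOfRecord₁₃SepCoPH θ ↦ datumOfRecord₁₃SepCoPHChi θ (Χ θ)`. [cite: Balaban1989LargeFieldI, (0.3)–(0.4) p.176 (bookkeeping)] -/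
theorem exists_provisos_of_isRecordOfRecord₁₃CSepCoPHCmap (h : IsRecordOfRecord₁₃CSepCoPHCmap F N Χ D w) :
    ∃ (θ : Stage13HParams F N) (hP : θ.Provisos₁₃SepCoPHChi F N (Χ θ.toStage13Params)), θ.Admissible F N ∧
      D = datumOfRecord₁₃SepCoPHChi F N θ (Χ θ.toStage13Params) hP := by
  obtain ⟨θ, hP, hθ, hD, -⟩ := h
  exact ⟨θ, hP, hθ, hD⟩

/-- Binding clause 1: the world's construction IS the datum's (parent :483). [cite: Balaban1989LargeFieldII, Thm 1 p.355 (bookkeeping)] -/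
theorem construction_eq_of_isRecordOfRecord₁₃CSepCoPHCmap (h : IsRecordOfRecord₁₃CSepCoPHCmap F N Χ D w) : w.C = D.C := by
  obtain ⟨θ, hP, -, -, hC, -⟩ := h
  exact hC

/-- Binding clause 2: the interval constant is positive (parent :488). [cite: Balaban1989LargeFieldII, Thm 1 p.355 (bookkeeping)] -/
theorem gamma_pos_of_isRecordOfRecord₁₃CSepCoPHCmap (h : IsRecordOfRecord₁₃CSepCoPHCmap F N Χ D w) : 0 < w.γ := by
  obtain ⟨θ, hP, -, -, -, hγ, -⟩ := h
  exact hγ.1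

/-- … and at most the presenting parameter's window letter (the second half of the window clause). [cite: Balaban1987RG1, (0.20) p.256 (bookkeeping)] -/
theorem exists_gamma_le_of_isRecordOfRecord₁₃CSepCoPHCmap (h : IsRecordOfRecord₁₃CSepCoPHCmap F N Χ D w) :
    ∃ (θ : Stage13HParams F N) (hP : θ.Provisos₁₃SepCoPHChi F N (Χ θ.toStage13Params)), D = datumOfRecord₁₃SepCoPHChi F N θ (Χ θ.toStage13Params) hP ∧
      w.γ ≤ θ.γ ∧ w.L = (θ.L : ℝ) := by
  obtain ⟨θ, hP, -, hD, -, hγ, hL, -⟩ := h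
  exact ⟨θ, hP, hD, hγ.2, hL⟩

/-- A centre-map record's datum is a datum of record, Stage 0 (parent :492; `[Ax-3d]` :280). [cite: Balaban1987RG1, (0.3)–(0.4) p.253 (bookkeeping)] -/
theorem isDatumOfRecord₀_of_isRecordOfRecord₁₃CSepCoPHCmap (h : IsRecordOfRecord₁₃CSepCoPHCmap F N Χ D w) : IsDatumOfRecord₀ F N D := by
  obtain ⟨θ, hP, -, rfl, -⟩ := h
  exact isDatumOfRecord₀_datumOfRecord₁₃SepCoPH_chi F N θ (Χ θ.toStage13Params) hP

/-- N23 · binder B1 at every centre-map record (parent :497). [cite: Balaban1987RG1, (0.4) p.253] -/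
theorem isPrintedAveraged_of_isRecordOfRecord₁₃CSepCoPHCmap (h : IsRecordOfRecord₁₃CSepCoPHCmap F N Χ D w) : D.IsPrintedAveraged :=
  isPrintedAveraged_of_isDatumOfRecord₀ F N D (isDatumOfRecord₀_of_isRecordOfRecord₁₃CSepCoPHCmap h)

/-- Ax instance of `exists_provisos_of_isRecordOfRecord₁₃CSepCoPH` (parent's arity; `[Ax-3d]`'s `Provisos₁₃SepCoPHAx` ∕ `datumOfRecord₁₃SepCoPHAx`, definitional).
[cite: Balaban1989LargeFieldI, (0.3)–(0.4) p.176 (bookkeeping)] -/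
theorem exists_provisos_of_isRecordOfRecord₁₃CSepCoPHCAx (h : IsRecordOfRecord₁₃CSepCoPHCAx F N D w) :
    ∃ (θ : Stage13HParams F N) (hP : θ.Provisos₁₃SepCoPHAx F N), θ.Admissible F N ∧ D = datumOfRecord₁₃SepCoPHAx F N θ hP :=
  exists_provisos_of_isRecordOfRecord₁₃CSepCoPHCmap h

/-- Ax instance of `construction_eq_of_isRecordOfRecord₁₃CSepCoPH` (parent's arity). [cite: Balaban1989LargeFieldII, Thm 1 p.355 (bookkeeping)] -/
theorem construction_eq_of_isRecordOfRecord₁₃CSepCoPHCAx (h : IsRecordOfRecord₁₃CSepCoPHCAx F N D w) : w.C = D.C :=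
  construction_eq_of_isRecordOfRecord₁₃CSepCoPHCmap h

/-- Ax instance of `gamma_pos_of_isRecordOfRecord₁₃CSepCoPH` (parent's arity). [cite: Balaban1989LargeFieldII, Thm 1 p.355 (bookkeeping)] -/
theorem gamma_pos_of_isRecordOfRecord₁₃CSepCoPHCAx (h : IsRecordOfRecord₁₃CSepCoPHCAx F N D w) : 0 < w.γ :=
  gamma_pos_of_isRecordOfRecord₁₃CSepCoPHCmap h

/-- Ax instance of `exists_gamma_le_of_isRecordOfRecord₁₃CSepCoPHCmap`. [cite: Balaban1987RG1, (0.20) p.256 (bookkeeping)] -/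
theorem exists_gamma_le_of_isRecordOfRecord₁₃CSepCoPHCAx (h : IsRecordOfRecord₁₃CSepCoPHCAx F N D w) :
    ∃ (θ : Stage13HParams F N) (hP : θ.Provisos₁₃SepCoPHAx F N), D = datumOfRecord₁₃SepCoPHAx F N θ hP ∧ w.γ ≤ θ.γ ∧ w.L = (θ.L : ℝ) :=
  exists_gamma_le_of_isRecordOfRecord₁₃CSepCoPHCmap h

/-- Ax instance of `isDatumOfRecord₀_of_isRecordOfRecord₁₃CSepCoPH` (parent's arity). [cite: Balaban1987RG1, (0.3)–(0.4) p.253 (bookkeeping)] -/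
theorem isDatumOfRecord₀_of_isRecordOfRecord₁₃CSepCoPHCAx (h : IsRecordOfRecord₁₃CSepCoPHCAx F N D w) : IsDatumOfRecord₀ F N D :=
  isDatumOfRecord₀_of_isRecordOfRecord₁₃CSepCoPHCmap h

/-- Ax instance of `isPrintedAveraged_of_isRecordOfRecord₁₃CSepCoPH` (parent's arity). [cite: Balaban1987RG1, (0.4) p.253] -/
theorem isPrintedAveraged_of_isRecordOfRecord₁₃CSepCoPHCAx (h : IsRecordOfRecord₁₃CSepCoPHCAx F N D w) : D.IsPrintedAveraged :=
  isPrintedAveraged_of_isRecordOfRecord₁₃CSepCoPHCmap h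

end ConsequencesCmap

/-! ## §3. ROW (3), first half: the §11c SHADOW at a FIXED β-slot `χ` (parents :542–:596 under `θ ↦ (θ, χ)`; every χ object read is landed in `[Ax-3b]`∕`[Ax-3c]`∕`[Ax-3d]`) -/

section ShadowChi

/-- **THE SHADOW RESIDUAL of `θ` under its χ-generic Stage-13 provisos** — parent :542 `shadowResidual₁₃SepCoPH` with `residualOfStage13CoPH ↦ residualOfStage13CoPHChi θ χ`,
`towerOfRecord₁₃SepCoPH ↦ towerOfRecord₁₃SepCoPHChi θ χ h`, `S218OfRecord₁₃CoPH ↦ S218OfRecord₁₃CoPHChi θ χ`, `densOfRecord₁₃ ↦ densOfRecord₁₃Chi … χ`; verbatim otherwise.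
A PROOF DEVICE. [cite: Balaban1989LargeFieldI, (0.2)–(0.4) p.176; Balaban1987RG1, (0.13) p.254 (bookkeeping)] -/
def shadowResidual₁₃SepCoPHChi (θ : Stage13HParams F N) (χ : ChiSlot F N) (h : θ.Provisos₁₃SepCoPHChi F N χ) : Residual₅ F N :=
  { residualOfStage13CoPHChi F N θ χ with
    R := fun p k => (towerOfRecord₁₃SepCoPHChi F N θ χ h).shadowR p k
    preservesIntegral_R := fun p k hk => (towerOfRecord₁₃SepCoPHChi F N θ χ h).preservesIntegral_shadowR p k hk (avOfRecord_measurable F N p.K k)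
      (avOfRecord_haarAC F N p.K k hk) (isIntegrable_towerOfRecord₁₃SepCoPH_chi F N θ χ h p k hk.le)
    integrable_R := fun p k hk => (towerOfRecord₁₃SepCoPHChi F N θ χ h).integrable_shadowR p k
      (isIntegrable_towerOfRecord₁₃SepCoPH_chi F N θ χ h p (k + 1) (Nat.succ_le_of_lt hk))
    S218 := fun p k _ => S218OfRecord₁₃CoPHChi F N θ χ p k (densOfRecord₁₃Chi F N θ.toStage13Params χ p k) }

/-- **THE SHADOW Stage-5 parameters of `θ` at slot `χ`** at interval letter `γ'` (parent :554). [cite: Balaban1989LargeFieldI, (0.2) p.176 (bookkeeping)] -/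
def shadow₅OfRecord₁₃SepCoPHChi (θ : Stage13HParams F N) (χ : ChiSlot F N) (h : θ.Provisos₁₃SepCoPHChi F N χ) (γ' : ℝ) : Stage5Params F N :=
  { θ.toStage5Params with γ := γ', res := shadowResidual₁₃SepCoPHChi F N θ χ h }

/-- THE KEY `rfl`: the machine of the shadow has core `coreOfRecord₁₃CoPHChi θ χ` (parent :558). [cite: Balaban1988Convergent, (0.2) p.244 (bookkeeping)] -/
theorem toCore_machineOfRecord₅_shadow₁₃SepCoPH_chi (θ : Stage13HParams F N) (χ : ChiSlot F N) (h : θ.Provisos₁₃SepCoPHChi F N χ) (γ' : ℝ) :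
    (machineOfRecord₅ F N (shadow₅OfRecord₁₃SepCoPHChi F N θ χ h γ')).toCore = coreOfRecord₁₃CoPHChi F N θ χ := rfl

/-- The shadow's residual `R` IS the tower's shadow operation (`rfl`; parent :562). [cite: Balaban1989LargeFieldI, (0.3) p.176 (bookkeeping)] -/
theorem res_R_shadow₁₃SepCoPH_chi (θ : Stage13HParams F N) (χ : ChiSlot F N) (h : θ.Provisos₁₃SepCoPHChi F N χ) (γ' : ℝ) (p : B12.RunParams) (k : ℕ) :
    (shadow₅OfRecord₁₃SepCoPHChi F N θ χ h γ').res.R p k = (towerOfRecord₁₃SepCoPHChi F N θ χ h).shadowR p k := rfl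

/-- The shadow is Stage-5 admissible iff `θ`'s Stage-1 dictionary is admissible and `0 < γ'` (parent :566). [cite: Balaban1989LargeFieldII, Thm 1 p.355 (bookkeeping)] -/
theorem admissible_shadow₁₃SepCoPH_chi (θ : Stage13HParams F N) (χ : ChiSlot F N) (h : θ.Provisos₁₃SepCoPHChi F N χ) {γ' : ℝ} (hθ : θ.Admissible F N)
    (hγ' : 0 < γ') : (shadow₅OfRecord₁₃SepCoPHChi F N θ χ h γ').Admissible :=
  ⟨hθ.1.1.1.1.1.1, hγ'⟩

/-- The shadow's upstream block IS the χ-generic Stage-13 view's (`rfl`; parent :571, `[Ax-3c]` :322). [cite: Balaban1985UV3, Thm 1 p.257 (bookkeeping)] -/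
theorem upOfRecord₅C_shadow₁₃SepCoPH_chi (θ : Stage13HParams F N) (χ : ChiSlot F N) (h : θ.Provisos₁₃SepCoPHChi F N χ) (γ' : ℝ) (P : B12.RunParams) :
    upOfRecord₅C F N (shadow₅OfRecord₁₃SepCoPHChi F N θ χ h γ') P = upOfRecord₅C F N (θ.toStage5₁₃CoPHChi F N χ) P := rfl

/-- The shadow datum has the SAME CONSTRUCTION as the χ-generic Stage-13 datum (parent :575). [cite: Balaban1989LargeFieldII, Thm 1 + (0.1) pp.355–356 (bookkeeping)] -/
theorem datumOfRecord₅_shadow₁₃SepCoPH_C_chi (θ : Stage13HParams F N) (χ : ChiSlot F N) (h : θ.Provisos₁₃SepCoPHChi F N χ) (γ' : ℝ) :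
    (datumOfRecord₅ F N (shadow₅OfRecord₁₃SepCoPHChi F N θ χ h γ')).C = (datumOfRecord₁₃SepCoPHChi F N θ χ h).C :=
  datumOfRecord_C_eq_datumOfTower F N (machineOfRecord₅ F N (shadow₅OfRecord₁₃SepCoPHChi F N θ χ h γ')) (towerOfRecord₁₃SepCoPHChi F N θ χ h)
    (fun _ _ => rfl)

/-- … the same densities (parent :580). [cite: Balaban1988Convergent, (0.2) p.244 (bookkeeping)] -/
theorem dens_datumOfRecord₅_shadow₁₃SepCoPH_chi (θ : Stage13HParams F N) (χ : ChiSlot F N) (h : θ.Provisos₁₃SepCoPHChi F N χ) (γ' : ℝ) (K : ℕ) (g₀ : ℝ)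
    (k : ℕ) : (datumOfRecord₅ F N (shadow₅OfRecord₁₃SepCoPHChi F N θ χ h γ')).dens K g₀ k = (datumOfRecord₁₃SepCoPHChi F N θ χ h).dens K g₀ k :=
  dens_datumOfRecord_eq_datumOfTower F N (machineOfRecord₅ F N (shadow₅OfRecord₁₃SepCoPHChi F N θ χ h γ')) (towerOfRecord₁₃SepCoPHChi F N θ χ h)
    (fun _ _ => rfl) K g₀ k

/-- … the same β-functions (`rfl`; parent :585). [cite: Balaban1987RG1, (1.22) p.264 (bookkeeping)] -/
theorem βfun_datumOfRecord₅_shadow₁₃SepCoPH_chi (θ : Stage13HParams F N) (χ : ChiSlot F N) (h : θ.Provisos₁₃SepCoPHChi F N χ) (γ' : ℝ) :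
    (datumOfRecord₅ F N (shadow₅OfRecord₁₃SepCoPHChi F N θ χ h γ')).βfun = (datumOfRecord₁₃SepCoPHChi F N θ χ h).βfun := rfl

/-- … and the same averaging maps (`rfl`; parent :589). [cite: Balaban1987RG1, (0.4) p.253 (bookkeeping)] -/
theorem av_datumOfRecord₅_shadow₁₃SepCoPH_chi (θ : Stage13HParams F N) (χ : ChiSlot F N) (h : θ.Provisos₁₃SepCoPHChi F N χ) (γ' : ℝ) :
    (datumOfRecord₅ F N (shadow₅OfRecord₁₃SepCoPHChi F N θ χ h γ')).av = (datumOfRecord₁₃SepCoPHChi F N θ χ h).av := rfl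

/-- **A χ-GENERIC STAGE-13 WORLD IS A STAGE-5 RECORD AT THE SHADOW DATUM** (parent :593 `isRecordOfRecord₅C_shadow₁₃SepCoPH` under σ; the generic `isRecordOfRecord₅C_shadow`).
[cite: Balaban1989LargeFieldII, Thm 1 + (0.1) pp.355–356 (bookkeeping)] -/
theorem isRecordOfRecord₅C_shadow₁₃SepCoPH_chi (θ : Stage13HParams F N) (χ : ChiSlot F N) (h : θ.Provisos₁₃SepCoPHChi F N χ) (hθ : θ.Admissible F N)
    (w : WorldP) (hC : w.C = (datumOfRecord₁₃SepCoPHChi F N θ χ h).C) (hγ : 0 < w.γ) (hL : w.L = (θ.L : ℝ))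
    (hup : ∀ P, w.up P = upOfRecord₅C F N (θ.toStage5₁₃CoPHChi F N χ) P) :
    IsRecordOfRecord₅C F N (datumOfRecord₅ F N (shadow₅OfRecord₁₃SepCoPHChi F N θ χ h w.γ)) w :=
  isRecordOfRecord₅C_shadow F N (shadow₅OfRecord₁₃SepCoPHChi F N θ χ h w.γ) (admissible_shadow₁₃SepCoPH_chi F N θ χ h hθ hγ)
    (towerOfRecord₁₃SepCoPHChi F N θ χ h) (fun _ _ => rfl) w hC rfl hL hup

end ShadowChi

/-! ## §4. ROW (3), second half: THE DOORS — refinement to the Stage-5 record predicate at the shadow, transfer of `AtRecord`-shaped node statements, the guarded (0.20) leaf and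
END FROM NODES at every centre-map record (parents :602–:652), each with the Ax instance of the parent's arity -/

section DoorsCmap

variable {F N}

/-- **REFINEMENT `IsRecordOfRecord₁₃CSepCoPHCmap Χ → IsRecordOfRecord₅C` AT THE SHADOW** (parent :602 under σ; the slot is `Χ θ` for the record's own presenting `θ`): every
centre-map record's world is a Stage-5 record at a datum with THE SAME construction, densities, β-functions and averaging maps.
[cite: Balaban1989LargeFieldII, Thm 1 + (0.1) pp.355–356 (bookkeeping)] -/
theorem exists_isRecordOfRecord₅C_of_isRecordOfRecord₁₃CSepCoPHCmap {Χ : CentreMap F N} {D : FiniteEpsData F (SU N)} {w : WorldP}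
    (h : IsRecordOfRecord₁₃CSepCoPHCmap F N Χ D w) :
    ∃ D₅ : FiniteEpsData F (SU N), IsRecordOfRecord₅C F N D₅ w ∧ D₅.C = D.C ∧ (∀ K g₀ k, D₅.dens K g₀ k = D.dens K g₀ k) ∧
      D₅.βfun = D.βfun ∧ D₅.av = D.av := by
  obtain ⟨θ, hP, hθ, rfl, hC, ⟨hγ0, -⟩, hL, hup⟩ := h
  exact ⟨_, isRecordOfRecord₅C_shadow₁₃SepCoPH_chi F N θ (Χ θ.toStage13Params) hP hθ w hC hγ0 hL hup,
    datumOfRecord₅_shadow₁₃SepCoPH_C_chi F N θ (Χ θ.toStage13Params) hP w.γ, dens_datumOfRecord₅_shadow₁₃SepCoPH_chi F N θ (Χ θ.toStage13Params) hP w.γ,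
    rfl, rfl⟩

/-- **TRANSFER** (parent :612 under σ): every node statement established over the Stage-5 record predicate in the `AtRecord` shape holds at every run of every centre-map
record's world. [cite: Balaban1989LargeFieldII, Thm 1 p.355 (bookkeeping)] -/
theorem atWorld_of_isRecordOfRecord₁₃CSepCoPHCmap {X : Dag.Leaves → Prop}
    (h₅ : ∀ (D : FiniteEpsData F (SU N)) (w : WorldP), IsRecordOfRecord₅C F N D w → ∀ P : B12.RunParams, X (leavesP w P))
    {Χ : CentreMap F N} {D : FiniteEpsData F (SU N)} {w : WorldP} (h : IsRecordOfRecord₁₃CSepCoPHCmap F N Χ D w) (P : B12.RunParams) : X (leavesP w P) := by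
  obtain ⟨D₅, h5, -⟩ := exists_isRecordOfRecord₅C_of_isRecordOfRecord₁₃CSepCoPHCmap h
  exact h₅ D₅ w h5 P

variable {Χ : CentreMap F N} {D : FiniteEpsData F (SU N)} {w : WorldP}

/-- Instance · GUARDED (0.20) at every centre-map record (parent :622). [cite: Balaban1987RG1, (0.20) p.256] -/
theorem rgFlow_of_smallCouplings_of_isRecordOfRecord₁₃CSepCoPHCmap (h : IsRecordOfRecord₁₃CSepCoPHCmap F N Χ D w) (P : B12.RunParams)
    (hsc : (leavesP w P).smallCouplings) : (leavesP w P).rgFlow := by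
  obtain ⟨D₅, h5, -⟩ := exists_isRecordOfRecord₅C_of_isRecordOfRecord₁₃CSepCoPHCmap h
  exact rgFlow_of_smallCouplings_of_isRecordOfRecord₅C h5 P hsc

/-- Instance · the END headline at a centre-map record needs NO `rgFlow` binder (parent :646). [cite: Balaban1989LargeFieldII, Thm 1 p.355 + p.391] -/
theorem endStatementBPrinted_of_isRecordOfRecord₁₃CSepCoPHCmap_of_nodes (h : IsRecordOfRecord₁₃CSepCoPHCmap F N Χ D w) {γ₀ : ℝ} (hγ₀ : w.γ ≤ γ₀)
    (hnodes : ∀ P, Nodes (leavesP w P)) (hβ : BetaBoundsInInterval w.C.toB12 γ₀ w.b w.βup) :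
    B16.EndStatementBPrinted D.C := by
  obtain ⟨D₅, h5, hC5, -⟩ := exists_isRecordOfRecord₅C_of_isRecordOfRecord₁₃CSepCoPHCmap h
  rw [← hC5]
  exact endStatementBPrinted_of_isRecordOfRecord₅C_of_nodes h5 hγ₀ hnodes hβ

/-- Ax instance of `exists_isRecordOfRecord₅C_of_isRecordOfRecord₁₃CSepCoPH` (parent's arity). [cite: Balaban1989LargeFieldII, Thm 1 + (0.1) pp.355–356 (bookkeeping)] -/
theorem exists_isRecordOfRecord₅C_of_isRecordOfRecord₁₃CSepCoPHCAx (h : IsRecordOfRecord₁₃CSepCoPHCAx F N D w) :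
    ∃ D₅ : FiniteEpsData F (SU N), IsRecordOfRecord₅C F N D₅ w ∧ D₅.C = D.C ∧ (∀ K g₀ k, D₅.dens K g₀ k = D.dens K g₀ k) ∧
      D₅.βfun = D.βfun ∧ D₅.av = D.av :=
  exists_isRecordOfRecord₅C_of_isRecordOfRecord₁₃CSepCoPHCmap h

/-- Ax instance of `atWorld_of_isRecordOfRecord₁₃CSepCoPH` (parent's arity). [cite: Balaban1989LargeFieldII, Thm 1 p.355 (bookkeeping)] -/
theorem atWorld_of_isRecordOfRecord₁₃CSepCoPHCAx {X : Dag.Leaves → Prop}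
    (h₅ : ∀ (D : FiniteEpsData F (SU N)) (w : WorldP), IsRecordOfRecord₅C F N D w → ∀ P : B12.RunParams, X (leavesP w P))
    {D : FiniteEpsData F (SU N)} {w : WorldP} (h : IsRecordOfRecord₁₃CSepCoPHCAx F N D w) (P : B12.RunParams) : X (leavesP w P) :=
  atWorld_of_isRecordOfRecord₁₃CSepCoPHCmap h₅ h P

/-- Ax instance of `rgFlow_of_smallCouplings_of_isRecordOfRecord₁₃CSepCoPH` (parent's arity) — the guarded (0.20) leaf plan g99's v11 consumer reads.
[cite: Balaban1987RG1, (0.20) p.256] -/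
theorem rgFlow_of_smallCouplings_of_isRecordOfRecord₁₃CSepCoPHCAx (h : IsRecordOfRecord₁₃CSepCoPHCAx F N D w) (P : B12.RunParams)
    (hsc : (leavesP w P).smallCouplings) : (leavesP w P).rgFlow :=
  rgFlow_of_smallCouplings_of_isRecordOfRecord₁₃CSepCoPHCmap h P hsc

/-- Ax instance of `endStatementBPrinted_of_isRecordOfRecord₁₃CSepCoPH_of_nodes` (parent's arity). [cite: Balaban1989LargeFieldII, Thm 1 p.355 + p.391] -/
theorem endStatementBPrinted_of_isRecordOfRecord₁₃CSepCoPHCAx_of_nodes (h : IsRecordOfRecord₁₃CSepCoPHCAx F N D w) {γ₀ : ℝ} (hγ₀ : w.γ ≤ γ₀)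
    (hnodes : ∀ P, Nodes (leavesP w P)) (hβ : BetaBoundsInInterval w.C.toB12 γ₀ w.b w.βup) :
    B16.EndStatementBPrinted D.C :=
  endStatementBPrinted_of_isRecordOfRecord₁₃CSepCoPHCmap_of_nodes h hγ₀ hnodes hβ

end DoorsCmap

end Literature.MathematicalPhysics.QuantumFieldTheory.Balaban1983to89.Node00

end
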